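import Summits.Ventures.PercRepro.RankLevelSetLevelSixBasisCell
import Summits.Ventures.PercRepro.RankLevelSetLevelSixCapGlue25
import Summits.Ventures.PercRepro.RankLevelSetLevelSixArithBasisSq24A

/-!
# PercRepro — THE 24 ROW, THE CELLS `(24, 21 ≤ d ≤ 29)` BY THE BASIS CELL, EVERY CORE (p8 g10, S3)

`proofs/SUBCLAIM-S3-p8.md` §3x. `c025_core_six_basis_cell` at rank `24` with the per-corank parameters of ArithBasisSq24A
(`ν₁`, `uG` in the unique-flat branch, `uH = 0`, `Kn / Kd`, the light constants `G` / `G'`), the spanning count from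
night-1's `ncard_spanning_le`; ratios `0.566 … 0.024`. Axioms: standard.
-/

open scoped Matroid

namespace PercRepro

namespace ThmN

open Set

variable {α : Type}

set_option maxHeartbeats 6000000 in
/-- **The `e`-free core at rank `24`, corank `21 ≤ d ≤ 29`, EVERY core** (the basis cell with the parts ArithBasisSq24A / B). -/
theorem c025_core_six_basis_sq24_mid1 (M : Matroid α) [M.Finite] (d : ℕ) (hdlo : 21 ≤ d) (hdhi : d ≤ 29)
    (hR : M.eRank = (24 : ℕ∞)) (hn : M.E.ncard = 24 + d)
    (hfree : ∀ e ∈ M.E, ∃ A ⊆ M.E \ {e}, e ∉ M.closure A ∧ e ∉ M.closure ((M.E \ {e}) \ A)) :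
    RLS M 24 6 := by
  classical
  have hEcard : M.ground_finite.toFinset.card = 24 + d := by
    rw [← Set.ncard_eq_toFinset_card _ M.ground_finite]; exact hn
  have hd : M.E.encard = M.eRank + d := by
    rw [hR, ← M.ground_finite.cast_ncard_eq, hn]
    push_cast
    ring
  have hsp : ({X : Set α | X ⊆ M.E ∧ M.eRk X = M.eRank}.ncard : ℚ) ≤
      ∑ j ∈ Finset.range (d + 1), (((24 + d).choose j : ℕ) : ℚ) := by
    have := Matroid.ncard_spanning_le (M := M) hd
    rw [hEcard] at this
    exact_mod_cast this
  have hΦ : phiK 24 6 ≤ (2 : ℚ) ^ (24 + 6) / (((24 + 6).choose 6 : ℕ) : ℚ) := phiK_le_two_pow_div_six 24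
  rw [RLS_iff]
  interval_cases d
  · refine c025_core_six_basis_cell M 24 21 18 1 1 27 0 2609 1000 ((24 + 6).choose 6) (Nat.choose_pos (by norm_num))
      (phiK 24 6) hΦ (by norm_num) (by norm_num) _ hsp (by norm_num) (by norm_num) (by norm_num) (by norm_num) (by norm_num)
      (by norm_num [cnull]) (by norm_num [cnull]) (Or.inr ⟨by norm_num, by norm_num⟩) (Or.inr (Or.inr (by norm_num)))
      (by norm_num) (by norm_num) (9241884 / 11305 : ℚ) (9241884 / 11305 : ℚ) (by norm_num) (by norm_num)
      ?_ ?_ ?_ hR hn hfree ?_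
    · exact basis_sq24_G_21
    · exact basis_sq24_Gp_21
    · exact basis_sq24_tail_21
    · exact basis_sq24_poly_21
  · refine c025_core_six_basis_cell M 24 22 19 1 1 28 0 2264 1000 ((24 + 6).choose 6) (Nat.choose_pos (by norm_num))
      (phiK 24 6) hΦ (by norm_num) (by norm_num) _ hsp (by norm_num) (by norm_num) (by norm_num) (by norm_num) (by norm_num)
      (by norm_num [cnull]) (by norm_num [cnull]) (Or.inr ⟨by norm_num, by norm_num⟩) (Or.inr (Or.inr (by norm_num)))
      (by norm_num) (by norm_num) (121172 / 147 : ℚ) (2388823 / 2898 : ℚ) (by norm_num) (by norm_num)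
      ?_ ?_ ?_ hR hn hfree ?_
    · exact basis_sq24_G_22
    · exact basis_sq24_Gp_22
    · exact basis_sq24_tail_22
    · exact basis_sq24_poly_22
  · refine c025_core_six_basis_cell M 24 23 19 1 1 29 0 1999 1000 ((24 + 6).choose 6) (Nat.choose_pos (by norm_num))
      (phiK 24 6) hΦ (by norm_num) (by norm_num) _ hsp (by norm_num) (by norm_num) (by norm_num) (by norm_num) (by norm_num)
      (by norm_num [cnull]) (by norm_num [cnull]) (Or.inr ⟨by norm_num, by norm_num⟩) (Or.inr (Or.inr (by norm_num)))
      (by norm_num) (by norm_num) (2786960 / 3381 : ℚ) (2388823 / 2898 : ℚ) (by norm_num) (by norm_num)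
      ?_ ?_ ?_ hR hn hfree ?_
    · exact basis_sq24_G_23
    · exact basis_sq24_Gp_23
    · exact basis_sq24_tail_23
    · exact basis_sq24_poly_23
  · refine c025_core_six_basis_cell M 24 24 20 1 1 30 0 1794 1000 ((24 + 6).choose 6) (Nat.choose_pos (by norm_num))
      (phiK 24 6) hΦ (by norm_num) (by norm_num) _ hsp (by norm_num) (by norm_num) (by norm_num) (by norm_num) (by norm_num)
      (by norm_num [cnull]) (by norm_num [cnull]) (Or.inr ⟨by norm_num, by norm_num⟩) (Or.inr (Or.inr (by norm_num)))
      (by norm_num) (by norm_num) (1339441 / 1254 : ℚ) (16743013 / 15675 : ℚ) (by norm_num) (by norm_num)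
      ?_ ?_ ?_ hR hn hfree ?_
    · exact basis_sq24_G_24
    · exact basis_sq24_Gp_24
    · exact basis_sq24_tail_24
    · exact basis_sq24_poly_24
  · refine c025_core_six_basis_cell M 24 25 20 1 1 31 0 1633 1000 ((24 + 6).choose 6) (Nat.choose_pos (by norm_num))
      (phiK 24 6) hΦ (by norm_num) (by norm_num) _ hsp (by norm_num) (by norm_num) (by norm_num) (by norm_num) (by norm_num)
      (by norm_num [cnull]) (by norm_num [cnull]) (Or.inr ⟨by norm_num, by norm_num⟩) (Or.inr (Or.inr (by norm_num)))
      (by norm_num) (by norm_num) (16743013 / 15675 : ℚ) (16743013 / 15675 : ℚ) (by norm_num) (by norm_num)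
      ?_ ?_ ?_ hR hn hfree ?_
    · exact basis_sq24_G_25
    · exact basis_sq24_Gp_25
    · exact basis_sq24_tail_25
    · exact basis_sq24_poly_25
  · refine c025_core_six_basis_cell M 24 26 21 1 1 32 0 1505 1000 ((24 + 6).choose 6) (Nat.choose_pos (by norm_num))
      (phiK 24 6) hΦ (by norm_num) (by norm_num) _ hsp (by norm_num) (by norm_num) (by norm_num) (by norm_num) (by norm_num)
      (by norm_num [cnull]) (by norm_num [cnull]) (Or.inr ⟨by norm_num, by norm_num⟩) (Or.inr (Or.inr (by norm_num)))
      (by norm_num) (by norm_num) (43087617 / 29900 : ℚ) (43087617 / 29900 : ℚ) (by norm_num) (by norm_num)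
      ?_ ?_ ?_ hR hn hfree ?_
    · exact basis_sq24_G_26
    · exact basis_sq24_Gp_26
    · exact basis_sq24_tail_26
    · exact basis_sq24_poly_26
  · refine c025_core_six_basis_cell M 24 27 21 1 1 33 0 1404 1000 ((24 + 6).choose 6) (Nat.choose_pos (by norm_num))
      (phiK 24 6) hΦ (by norm_num) (by norm_num) _ hsp (by norm_num) (by norm_num) (by norm_num) (by norm_num) (by norm_num)
      (by norm_num [cnull]) (by norm_num [cnull]) (Or.inr ⟨by norm_num, by norm_num⟩) (Or.inr (Or.inr (by norm_num)))
      (by norm_num) (by norm_num) (43087617 / 29900 : ℚ) (43087617 / 29900 : ℚ) (by norm_num) (by norm_num)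
      ?_ ?_ ?_ hR hn hfree ?_
    · exact basis_sq24_G_27
    · exact basis_sq24_Gp_27
    · exact basis_sq24_tail_27
    · exact basis_sq24_poly_27
  · refine c025_core_six_basis_cell M 24 28 22 1 1 34 0 1323 1000 ((24 + 6).choose 6) (Nat.choose_pos (by norm_num))
      (phiK 24 6) hΦ (by norm_num) (by norm_num) _ hsp (by norm_num) (by norm_num) (by norm_num) (by norm_num) (by norm_num)
      (by norm_num [cnull]) (by norm_num [cnull]) (Or.inr ⟨by norm_num, by norm_num⟩) (Or.inr (Or.inr (by norm_num)))
      (by norm_num) (by norm_num) (83822590 / 41769 : ℚ) (83822590 / 41769 : ℚ) (by norm_num) (by norm_num)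
      ?_ ?_ ?_ hR hn hfree ?_
    · exact basis_sq24_G_28
    · exact basis_sq24_Gp_28
    · exact basis_sq24_tail_28
    · exact basis_sq24_poly_28
  · refine c025_core_six_basis_cell M 24 29 22 1 1 35 0 1257 1000 ((24 + 6).choose 6) (Nat.choose_pos (by norm_num))
      (phiK 24 6) hΦ (by norm_num) (by norm_num) _ hsp (by norm_num) (by norm_num) (by norm_num) (by norm_num) (by norm_num)
      (by norm_num [cnull]) (by norm_num [cnull]) (Or.inr ⟨by norm_num, by norm_num⟩) (Or.inr (Or.inr (by norm_num)))
      (by norm_num) (by norm_num) (83822590 / 41769 : ℚ) (83822590 / 41769 : ℚ) (by norm_num) (by norm_num)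
      ?_ ?_ ?_ hR hn hfree ?_
    · exact basis_sq24_G_29
    · exact basis_sq24_Gp_29
    · exact basis_sq24_tail_29
    · exact basis_sq24_poly_29

end ThmN

end PercRepro
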